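import Literature.Probability.Percolation.QSMPolynomials
import HarnessLib

/-!
# The Aizenman–Grimmett differential inequality and the line-segment argument, abstractly
# (Martineau–Severo 2019, §6: from Lemma 6.1 to Proposition 4.2)

Support file of the inline proof of `Literature.Probability.Percolation.MartineauSevero2019_cor22`.
Martineau–Severo (Ann. Probab. 47 (2019), §6) deduce Proposition 4.2 from the deterministic
Lemma 6.1 in three steps that use nothing about the graph beyond finiteness of the coordinate set
carrying `𝓔_L` and uniform bounds on the size of the modification window:

* **finite energy / bounded fibres** (Lemma 6.1 ⟹ (goal)): a local modification `S ↦ S'` that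
  changes at most `N_E` edge coordinates (parameters in `[μ₀, 1-μ₀]`), only REMOVES marks
  (`s ≤ 1/2`), agrees with `S` off a window `Loc(e)` of size `≤ N_E + N_V`, and produces an
  `s`-pivotal vertex `y ∈ near(e)`, gives `Piv_e ≤ μ₀^{-N_E} 2^{N_E+N_V} Σ_{y ∈ near(e)} Piv_y`;
* **overlap** ((goal) ⟹ (diffineq)): if every vertex is near at most `N_M` edges,
  `Σ_e Piv_e ≤ C Σ_y Piv_y` with `C = μ₀^{-N_E} 2^{N_E+N_V} N_M` uniform in `L`;
* **the line segment**: by Russo's formula in both parameters, `t ↦ θ_L(p₀ - κt, t)` is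
  non-decreasing on `[0, t₁]` when `κ C ≤ 1`, and `θ_L(p, s)` is non-decreasing in `s`.

The tree carries these out for the column model of the special case `ℤ³ → C_n □ ℤ²`
(`SlabTorus.exists_modified`, `piv_inl_le`, `sum_piv_inl_le`, `theta_line_mono`, `theta_mono_s` in
`QSMPolynomials.lean`); this file is that argument with the geometry abstracted into the data
`(K_E, K_V, C_E, C_V, N_E, N_V, N_M)` and the local modification as a hypothesis (`AGLine.LocMod`,
a plain implication in the statements, no named fact), on the explicit two-parameter polynomials
`ProdWeight.gTheta`/`gPiv`. The general quotient case instantiates it with the enhanced cluster of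
`EnhancedCluster.lean` and Lemma 6.1 of `EnhancedClusterModification.lean`.

* `AGLine.par`, `AGLine.Theta`, `AGLine.Piv` — the parameters `(p on K_E, s on K_V)`, `θ_L(p,s)` and
  the pivotal counts as polynomials on `K = K_E ⊔ K_V`; `hasDerivAt_theta_line` (Russo along the line);
* `AGLine.gW_le_of_modification` — the weight comparison `μ₀^{N_E} W(S) ≤ W(S')`;
* `AGLine.piv_inl_le`, `AGLine.sum_piv_inl_le` — (goal) and (diffineq);
* `AGLine.theta_line_mono`, `AGLine.theta_mono_s` — the line-segment argument.

## References

* S. Martineau, F. Severo, Ann. Probab. 47 (2019), §6 ((diffineq), (goal), Lemma 6.1, the line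
  segment) [MartineauSevero2019].
* M. Aizenman, G. Grimmett, J. Stat. Phys. 63 (1991) 817–835 [AizenmanGrimmett1991].
* L. Russo, Z. Wahrsch. verw. Gebiete 56 (1981), §4 Lemma 3 (Russo's formula).
-/

namespace Literature.Probability.Percolation

namespace AGLine

open scoped Classical

variable {κE κV : Type*}

/-! ### The two-parameter polynomials -/

/-- The parameter of a coordinate: `p` for edges, `s` for marks. [cite: MartineauSevero2019, §4 (ℙ_{p,s})] -/
def par (p s : ℝ) : κE ⊕ κV → ℝ := fun i => Sum.elim (fun _ => p) (fun _ => s) i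

/-- Parameters in `[0, 1]` coordinatewise. [folklore] -/
theorem par_mem {p s : ℝ} (hp : 0 ≤ p ∧ p ≤ 1) (hs : 0 ≤ s ∧ s ≤ 1) (i : κE ⊕ κV) :
    0 ≤ par p s i ∧ par p s i ≤ 1 := by
  cases i with
  | inl _ => exact hp
  | inr _ => exact hs

variable (KE : Finset κE) (KV : Finset κV) (A : Set (Set (κE ⊕ κV)))

/-- The finite coordinate set `K = K_E ⊔ K_V`. [cite: MartineauSevero2019, §6 ("𝓔_L depends only on finitely many coordinates")] -/
def K : Finset (κE ⊕ κV) := KE.disjSum KV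

/-- **`θ_L(p, s) = Σ_{S ⊆ K, S ∈ A} ∏ w_i(S)`**, the finite-volume probability of the increasing event
`A` under `ℙ_{p,s}`, as a polynomial. [cite: MartineauSevero2019, §6 (θ_L(p,s))] -/
noncomputable def Theta (p s : ℝ) : ℝ := ProdWeight.gTheta (K KE KV) A (par p s)

/-- The weighted count of configurations in which the coordinate `i` is pivotal for `A`
(`ℙ_{p,s}(e is p-pivotal)`, `ℙ_{p,s}(x is s-pivotal)`). [cite: MartineauSevero2019, §6] -/
noncomputable def Piv (p s : ℝ) (i : κE ⊕ κV) : ℝ := ProdWeight.gPiv (K KE KV) A (par p s) i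

variable {KE KV A}

/-- Membership of an edge coordinate in `K`. [folklore] -/
@[simp] theorem inl_mem_K {e : κE} : (Sum.inl e : κE ⊕ κV) ∈ K KE KV ↔ e ∈ KE := Finset.inl_mem_disjSum

/-- Membership of a mark coordinate in `K`. [folklore] -/
@[simp] theorem inr_mem_K {y : κV} : (Sum.inr y : κE ⊕ κV) ∈ K KE KV ↔ y ∈ KV := Finset.inr_mem_disjSum

/-- Pivotal counts are non-negative. [folklore] -/
theorem piv_nonneg {p s : ℝ} (hp : 0 ≤ p ∧ p ≤ 1) (hs : 0 ≤ s ∧ s ≤ 1) (i : κE ⊕ κV) :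
    0 ≤ Piv KE KV A p s i :=
  ProdWeight.gPiv_nonneg _ _ (par_mem hp hs) i

/-- **Russo's formula for `θ_L` along the line `(p₀ - κt, t)`**: the derivative is
`-κ Σ_e Piv_e + Σ_y Piv_y`. [cite: MartineauSevero2019, §6 (Margulis–Russo formula, chain rule along the segment)] -/
theorem hasDerivAt_theta_line (hA : IsUpperSet A) (p₀ κ t : ℝ) :
    HasDerivAt (fun t => Theta KE KV A (p₀ - κ * t) t)
      (-κ * ∑ e ∈ KE, Piv KE KV A (p₀ - κ * t) t (Sum.inl e) +
        ∑ y ∈ KV, Piv KE KV A (p₀ - κ * t) t (Sum.inr y)) t := by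
  have hq : ∀ i ∈ K KE KV, HasDerivAt (fun t => par (κE := κE) (κV := κV) (p₀ - κ * t) t i)
      (Sum.elim (fun _ => -κ) (fun _ => (1 : ℝ)) i) t := by
    intro i _
    cases i with
    | inl e =>
      simp only [par, Sum.elim_inl]
      have := ((hasDerivAt_id t).const_mul κ).const_sub p₀
      simpa using this
    | inr y =>
      simp only [par, Sum.elim_inr]
      exact hasDerivAt_id t
  have h := ProdWeight.hasDerivAt_gTheta hA (K KE KV) hq
  refine h.congr_deriv ?_
  simp only [Piv, K, Finset.sum_disjSum, Sum.elim_inl, Sum.elim_inr, one_mul, Finset.mul_sum]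

/-! ### The weight comparison of a local modification -/

/-- **Finite energy.** If `S' ⊆ K` is obtained from `S ⊆ K` by changing edge coordinates only inside
`CE` and by removing marks, and `μ₀ ≤ p ≤ 1 - μ₀`, `0 ≤ s ≤ 1/2`, then
`μ₀^{|CE|} W(S) ≤ W(S')`. [cite: MartineauSevero2019, §6 (Lemma 6.1 ⟹ (goal): "differing from (ω,α) only inside B_R(e)")] -/
theorem gW_le_of_modification {p s μ₀ : ℝ} (hμ₀ : 0 ≤ μ₀) (hμ1 : μ₀ ≤ 1) (hμp : μ₀ ≤ p)
    (hμp' : μ₀ ≤ 1 - p) (hs0 : 0 ≤ s) (hs1 : s ≤ 1) (hs : s ≤ 1 / 2) (CE : Finset κE)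
    {S S' : Finset (κE ⊕ κV)}
    (hedge : ∀ f : κE, f ∉ CE → ((Sum.inl f : κE ⊕ κV) ∈ S ↔ (Sum.inl f : κE ⊕ κV) ∈ S'))
    (hmark : ∀ y : κV, (Sum.inr y : κE ⊕ κV) ∈ S' → (Sum.inr y : κE ⊕ κV) ∈ S) :
    μ₀ ^ CE.card * ProdWeight.gW (K KE KV) (par p s) S ≤ ProdWeight.gW (K KE KV) (par p s) S' := by
  set CF : Finset (κE ⊕ κV) := CE.disjSum (∅ : Finset κV) with hCF
  set cc : κE ⊕ κV → ℝ := fun i => if i ∈ CF then μ₀ else 1 with hcc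
  have hq := par_mem (κE := κE) (κV := κV) (p := p) (s := s) ⟨hμ₀.trans hμp, by linarith⟩ ⟨hs0, hs1⟩
  have hfac : ∀ i ∈ K KE KV, cc i * ProdWeight.gwt (par p s) S i ≤ ProdWeight.gwt (par p s) S' i := by
    intro i _
    by_cases hiC : i ∈ CF
    · -- a changed edge: finite energy
      simp only [hcc, hiC, if_true]
      obtain ⟨f, -, rfl⟩ : ∃ f, f ∈ CE ∧ Sum.inl f = i := by
        rcases Finset.mem_disjSum.1 hiC with ⟨f, hf, hfi⟩ | ⟨y', hy', -⟩
        · exact ⟨f, hf, hfi⟩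
        · simp at hy'
      calc μ₀ * ProdWeight.gwt (par p s) S (Sum.inl f)
          ≤ μ₀ * 1 := mul_le_mul_of_nonneg_left (ProdWeight.gwt_le_one hq S _) hμ₀
        _ ≤ ProdWeight.gwt (par p s) S' (Sum.inl f) := by
          rw [mul_one]
          unfold ProdWeight.gwt
          split_ifs
          · exact hμp
          · simpa [par] using hμp'
    · simp only [hcc, hiC, if_false, one_mul]
      cases i with
      | inl f =>
        have hf : f ∉ CE := fun h => hiC (Finset.inl_mem_disjSum.2 h)
        have := hedge f hf
        unfold ProdWeight.gwt
        by_cases h : (Sum.inl f : κE ⊕ κV) ∈ S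
        · have h' := this.1 h
          simp [h, h']
        · have h' : (Sum.inl f : κE ⊕ κV) ∉ S' := fun x => h (this.2 x)
          simp [h, h']
      | inr y' =>
        unfold ProdWeight.gwt
        by_cases h1 : (Sum.inr y' : κE ⊕ κV) ∈ S'
        · have h2 := hmark y' h1
          simp [h1, h2]
        · by_cases h2 : (Sum.inr y' : κE ⊕ κV) ∈ S
          · simp only [h2, if_true, h1, if_false, par, Sum.elim_inr]
            linarith
          · simp [h1, h2]
  have hcc0 : ∀ i ∈ K KE KV, 0 ≤ cc i * ProdWeight.gwt (par p s) S i := fun i _ =>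
    mul_nonneg (by simp only [hcc]; split_ifs <;> linarith) (ProdWeight.gwt_nonneg hq S i)
  have hprod : (∏ i ∈ K KE KV, cc i) * ProdWeight.gW (K KE KV) (par p s) S ≤
      ProdWeight.gW (K KE KV) (par p s) S' := by
    unfold ProdWeight.gW
    rw [← Finset.prod_mul_distrib]
    exact Finset.prod_le_prod hcc0 hfac
  have hcprod : μ₀ ^ CE.card ≤ ∏ i ∈ K KE KV, cc i := by
    rw [Finset.prod_ite, Finset.prod_const_one, mul_one, Finset.prod_const]
    refine pow_le_pow_of_le_one hμ₀ hμ1 ?_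
    calc ((K KE KV).filter fun i => i ∈ CF).card ≤ CF.card :=
          Finset.card_le_card fun i hi => (Finset.mem_filter.1 hi).2
      _ = CE.card := by rw [hCF, Finset.card_disjSum, Finset.card_empty, add_zero]
  calc μ₀ ^ CE.card * ProdWeight.gW (K KE KV) (par p s) S
      ≤ (∏ i ∈ K KE KV, cc i) * ProdWeight.gW (K KE KV) (par p s) S :=
        mul_le_mul_of_nonneg_right hcprod (ProdWeight.gW_nonneg _ hq S)
    _ ≤ ProdWeight.gW (K KE KV) (par p s) S' := hprod

/-! ### From local modifications to (goal) and (diffineq) -/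

section AG

variable (KE KV A)

/-- **The local modification property** (the conclusion of Martineau–Severo's Lemma 6.1 on finite
configurations, as consumed by the counting): every `S ⊆ K` in which the edge coordinate `e ∈ K_E` is
pivotal admits `S' ⊆ K` with an `s`-pivotal mark `y ∈ C_V(e) ∩ K_V`, agreeing with `S` off
`C_E(e) ⊔ C_V(e)`, changing edge coordinates only inside `C_E(e)`, and containing no new marks.
[cite: MartineauSevero2019, Lemma 6.1] -/
def LocMod (CE : κE → Finset κE) (CV : κE → Finset κV) : Prop :=
  ∀ e ∈ KE, ∀ S ⊆ K KE KV, IsPivotal A (Sum.inl e) (↑S : Set (κE ⊕ κV)) →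
    ∃ S' ⊆ K KE KV,
      (∃ y ∈ KV, y ∈ CV e ∧ IsPivotal A (Sum.inr y) (↑S' : Set (κE ⊕ κV))) ∧
      (∀ i, i ∉ (CE e).disjSum (CV e) → (i ∈ S ↔ i ∈ S')) ∧
      (∀ f : κE, f ∉ CE e → ((Sum.inl f : κE ⊕ κV) ∈ S ↔ (Sum.inl f : κE ⊕ κV) ∈ S')) ∧
      (∀ y : κV, (Sum.inr y : κE ⊕ κV) ∈ S' → (Sum.inr y : κE ⊕ κV) ∈ S)

variable {KE KV A}

/-- **Martineau–Severo's (goal), summed locally**: under the local modification property with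
`|C_E(e)| ≤ N_E`, `|C_V(e)| ≤ N_V`, for `μ₀ ≤ p ≤ 1-μ₀`, `0 ≤ s ≤ 1/2`:
`Piv_e ≤ μ₀^{-N_E} 2^{N_E+N_V} Σ_{y ∈ K_V ∩ C_V(e)} Piv_y`. [cite: MartineauSevero2019, §6 (goal)] -/
theorem piv_inl_le {CE : κE → Finset κE} {CV : κE → Finset κV} (hmod : LocMod KE KV A CE CV)
    {NE NV : ℕ} (hNE : ∀ e ∈ KE, (CE e).card ≤ NE) (hNV : ∀ e ∈ KE, (CV e).card ≤ NV)
    {p s μ₀ : ℝ} (hμ₀ : 0 < μ₀) (hμ1 : μ₀ ≤ 1)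
    (hμp : μ₀ ≤ p) (hμp' : μ₀ ≤ 1 - p) (hs0 : 0 ≤ s) (hs1 : s ≤ 1) (hs : s ≤ 1 / 2)
    {e : κE} (he : e ∈ KE) :
    Piv KE KV A p s (Sum.inl e) ≤ (μ₀ ^ NE)⁻¹ * 2 ^ (NE + NV) *
      ∑ y ∈ KV.filter (fun y => y ∈ CV e), Piv KE KV A p s (Sum.inr y) := by
  set q := par (κE := κE) (κV := κV) p s with hq_def
  have hq := par_mem (κE := κE) (κV := κV) (p := p) (s := s) ⟨hμ₀.le.trans hμp, by linarith⟩ ⟨hs0, hs1⟩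
  set Loc : Finset (κE ⊕ κV) := (CE e).disjSum (CV e) with hLoc
  set D : Finset (Finset (κE ⊕ κV)) :=
    (K KE KV).powerset.filter fun S => IsPivotal A (Sum.inl e) (↑S : Set (κE ⊕ κV)) with hD
  -- the modification map
  have hex : ∀ S ∈ D, ∃ S' : Finset (κE ⊕ κV), S' ⊆ K KE KV ∧
      (∃ y ∈ KV, y ∈ CV e ∧ IsPivotal A (Sum.inr y) (↑S' : Set (κE ⊕ κV))) ∧
      μ₀ ^ NE * ProdWeight.gW (K KE KV) q S ≤ ProdWeight.gW (K KE KV) q S' ∧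
      S.filter (fun i => i ∉ Loc) = S'.filter (fun i => i ∉ Loc) := by
    intro S hS
    obtain ⟨hSK, hpiv⟩ := Finset.mem_filter.1 hS
    obtain ⟨S', hS'K, hy, hoff, hedge, hmark⟩ := hmod e he S (Finset.mem_powerset.1 hSK) hpiv
    refine ⟨S', hS'K, hy, ?_, ?_⟩
    · have h1 := gW_le_of_modification (KE := KE) (KV := KV) hμ₀.le hμ1 hμp hμp' hs0 hs1 hs (CE e) hedge hmark
      refine le_trans ?_ h1
      refine mul_le_mul_of_nonneg_right ?_ (ProdWeight.gW_nonneg _ hq S)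
      exact pow_le_pow_of_le_one hμ₀.le hμ1 (hNE e he)
    · ext i
      simp only [Finset.mem_filter]
      constructor
      · rintro ⟨hi, hiL⟩; exact ⟨(hoff i hiL).1 hi, hiL⟩
      · rintro ⟨hi, hiL⟩; exact ⟨(hoff i hiL).2 hi, hiL⟩
  choose! Φ hΦK hΦpiv hΦw hΦoff using hex
  -- Step A: finite energy
  have hA : Piv KE KV A p s (Sum.inl e) ≤ (μ₀ ^ NE)⁻¹ * ∑ S ∈ D, ProdWeight.gW (K KE KV) q (Φ S) := by
    have hPiv : Piv KE KV A p s (Sum.inl e) = ∑ S ∈ D, ProdWeight.gW (K KE KV) q S := by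
      rw [Piv, ProdWeight.gPiv, hD, Finset.sum_filter]
    rw [hPiv, Finset.mul_sum]
    refine Finset.sum_le_sum fun S hS => ?_
    have hμn : 0 < μ₀ ^ NE := pow_pos hμ₀ _
    rw [← div_le_iff₀' (inv_pos.2 hμn), div_inv_eq_mul, mul_comm]
    exact hΦw S hS
  -- Step B: bounded fibres
  have hLoccard : Loc.card ≤ NE + NV := by
    rw [hLoc, Finset.card_disjSum]
    exact Nat.add_le_add (hNE e he) (hNV e he)
  have hB : ∑ S ∈ D, ProdWeight.gW (K KE KV) q (Φ S) ≤
      2 ^ (NE + NV) * ∑ S' ∈ D.image Φ, ProdWeight.gW (K KE KV) q S' := by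
    rw [Finset.sum_comp, Finset.mul_sum]
    refine Finset.sum_le_sum fun S' hS' => ?_
    rw [nsmul_eq_mul]
    refine mul_le_mul_of_nonneg_right ?_ (ProdWeight.gW_nonneg _ hq S')
    have hcard : (D.filter fun S => Φ S = S').card ≤ Loc.powerset.card := by
      refine Finset.card_le_card_of_injOn (fun S => S.filter fun i => i ∈ Loc) ?_ ?_
      · intro S _
        simp only [Finset.coe_powerset, Set.mem_preimage, Set.mem_powerset_iff, Finset.coe_subset]
        exact fun i hi => (Finset.mem_filter.1 hi).2
      · intro S₁ hS₁ S₂ hS₂ hEq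
        simp only [Finset.coe_filter, Set.mem_setOf_eq] at hS₁ hS₂
        have h1 := hΦoff S₁ hS₁.1
        have h2 := hΦoff S₂ hS₂.1
        rw [hS₁.2] at h1
        rw [hS₂.2] at h2
        rw [← Finset.filter_union_filter_not_eq (fun i => i ∈ Loc) S₁,
          ← Finset.filter_union_filter_not_eq (fun i => i ∈ Loc) S₂]
        simp only at hEq
        rw [hEq, h1, ← h2]
    calc ((D.filter fun S => Φ S = S').card : ℝ) ≤ (Loc.powerset.card : ℝ) := by exact_mod_cast hcard
      _ = 2 ^ Loc.card := by rw [Finset.card_powerset]; push_cast; ring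
      _ ≤ 2 ^ (NE + NV) := pow_le_pow_right₀ (by norm_num) hLoccard
  -- Step C: the images are configurations with a pivotal mark in `CV e`
  set box := KV.filter (fun y => y ∈ CV e) with hbox
  have hC : ∑ S' ∈ D.image Φ, ProdWeight.gW (K KE KV) q S' ≤
      ∑ y ∈ box, Piv KE KV A p s (Sum.inr y) := by
    set P : Finset (κE ⊕ κV) → Prop := fun S' =>
      ∃ y ∈ box, IsPivotal A (Sum.inr y) (↑S' : Set (κE ⊕ κV)) with hP
    have hsub : D.image Φ ⊆ (K KE KV).powerset.filter P := by
      intro S' hS'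
      obtain ⟨S, hS, rfl⟩ := Finset.mem_image.1 hS'
      refine Finset.mem_filter.2 ⟨Finset.mem_powerset.2 (hΦK S hS), ?_⟩
      obtain ⟨y, hy, hyc, hpiv⟩ := hΦpiv S hS
      exact ⟨y, Finset.mem_filter.2 ⟨hy, hyc⟩, hpiv⟩
    set g : Finset (κE ⊕ κV) → κV → ℝ := fun S' y =>
      if IsPivotal A (Sum.inr y) (↑S' : Set (κE ⊕ κV)) then ProdWeight.gW (K KE KV) q S' else 0 with hg
    have hg0 : ∀ S' y, 0 ≤ g S' y := fun S' y => by
      simp only [hg]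
      split_ifs
      · exact ProdWeight.gW_nonneg _ hq S'
      · exact le_rfl
    calc ∑ S' ∈ D.image Φ, ProdWeight.gW (K KE KV) q S'
        ≤ ∑ S' ∈ (K KE KV).powerset.filter P, ProdWeight.gW (K KE KV) q S' :=
          Finset.sum_le_sum_of_subset_of_nonneg hsub fun S' _ _ => ProdWeight.gW_nonneg _ hq S'
      _ ≤ ∑ S' ∈ (K KE KV).powerset.filter P, ∑ y ∈ box, g S' y := by
          refine Finset.sum_le_sum fun S' hS' => ?_
          obtain ⟨-, y, hy, hpiv⟩ := Finset.mem_filter.1 hS'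
          have hle : g S' y ≤ ∑ y' ∈ box, g S' y' := Finset.single_le_sum (f := g S') (fun y' _ => hg0 S' y') hy
          have hgy : g S' y = ProdWeight.gW (K KE KV) q S' := by simp [hg, hpiv]
          rw [hgy] at hle
          exact hle
      _ ≤ ∑ S' ∈ (K KE KV).powerset, ∑ y ∈ box, g S' y :=
          Finset.sum_le_sum_of_subset_of_nonneg (Finset.filter_subset _ _) fun S' _ _ =>
            Finset.sum_nonneg fun y _ => hg0 S' y
      _ = ∑ y ∈ box, Piv KE KV A p s (Sum.inr y) := by
          rw [Finset.sum_comm]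
          rfl
  -- assemble
  have h2pos : (0 : ℝ) ≤ 2 ^ (NE + NV) := by positivity
  have hμinv : (0 : ℝ) ≤ (μ₀ ^ NE)⁻¹ := inv_nonneg.2 (pow_nonneg hμ₀.le _)
  calc Piv KE KV A p s (Sum.inl e)
      ≤ (μ₀ ^ NE)⁻¹ * ∑ S ∈ D, ProdWeight.gW (K KE KV) q (Φ S) := hA
    _ ≤ (μ₀ ^ NE)⁻¹ * (2 ^ (NE + NV) * ∑ S' ∈ D.image Φ, ProdWeight.gW (K KE KV) q S') :=
        mul_le_mul_of_nonneg_left hB hμinv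
    _ ≤ (μ₀ ^ NE)⁻¹ * (2 ^ (NE + NV) * ∑ y ∈ box, Piv KE KV A p s (Sum.inr y)) :=
        mul_le_mul_of_nonneg_left (mul_le_mul_of_nonneg_left hC h2pos) hμinv
    _ = _ := by ring

/-- The constant of the Aizenman–Grimmett inequality:
`C = μ₀^{-N_E} · 2^{N_E+N_V} · N_M` (finite energy · fibre multiplicity · overlap of the windows).
[cite: MartineauSevero2019, §6 ("which implies (diffineq) for c := c'/C")] -/
noncomputable def AGconst (NE NV NM : ℕ) (μ₀ : ℝ) : ℝ := (μ₀ ^ NE)⁻¹ * 2 ^ (NE + NV) * NM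

/-- `0 ≤ AGconst`. [folklore] -/
theorem AGconst_nonneg (NE NV NM : ℕ) {μ₀ : ℝ} (hμ₀ : 0 ≤ μ₀) : 0 ≤ AGconst NE NV NM μ₀ := by
  unfold AGconst
  exact mul_nonneg (mul_nonneg (inv_nonneg.2 (pow_nonneg hμ₀ _)) (by positivity)) (Nat.cast_nonneg _)

/-- **The Aizenman–Grimmett inequality ((goal) summed over `e`, giving (diffineq))**: with the overlap
bound `#{e ∈ K_E : y ∈ C_V(e)} ≤ N_M` for every `y`, `Σ_{e ∈ K_E} Piv_e ≤ C · Σ_{y ∈ K_V} Piv_y`.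
[cite: MartineauSevero2019, §6 ((goal) ⟹ (diffineq))] -/
theorem sum_piv_inl_le {CE : κE → Finset κE} {CV : κE → Finset κV} (hmod : LocMod KE KV A CE CV)
    {NE NV NM : ℕ} (hNE : ∀ e ∈ KE, (CE e).card ≤ NE) (hNV : ∀ e ∈ KE, (CV e).card ≤ NV)
    (hNM : ∀ y ∈ KV, (KE.filter fun e => y ∈ CV e).card ≤ NM)
    {p s μ₀ : ℝ} (hμ₀ : 0 < μ₀) (hμ1 : μ₀ ≤ 1)
    (hμp : μ₀ ≤ p) (hμp' : μ₀ ≤ 1 - p) (hs0 : 0 ≤ s) (hs1 : s ≤ 1) (hs : s ≤ 1 / 2) :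
    ∑ e ∈ KE, Piv KE KV A p s (Sum.inl e) ≤ AGconst NE NV NM μ₀ * ∑ y ∈ KV, Piv KE KV A p s (Sum.inr y) := by
  have hq := par_mem (κE := κE) (κV := κV) (p := p) (s := s) ⟨hμ₀.le.trans hμp, by linarith⟩ ⟨hs0, hs1⟩
  set C₁ : ℝ := (μ₀ ^ NE)⁻¹ * 2 ^ (NE + NV) with hC₁
  have hC₁0 : 0 ≤ C₁ := mul_nonneg (inv_nonneg.2 (pow_nonneg hμ₀.le _)) (by positivity)
  have hPiv0 : ∀ y, 0 ≤ Piv KE KV A p s (Sum.inr y) := fun y =>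
    piv_nonneg ⟨hμ₀.le.trans hμp, by linarith⟩ ⟨hs0, hs1⟩ _
  calc ∑ e ∈ KE, Piv KE KV A p s (Sum.inl e)
      ≤ ∑ e ∈ KE, C₁ * ∑ y ∈ KV.filter (fun y => y ∈ CV e), Piv KE KV A p s (Sum.inr y) :=
        Finset.sum_le_sum fun e he => piv_inl_le hmod hNE hNV hμ₀ hμ1 hμp hμp' hs0 hs1 hs he
    _ = C₁ * ∑ e ∈ KE, ∑ y ∈ KV, (if y ∈ CV e then Piv KE KV A p s (Sum.inr y) else 0) := by
        rw [← Finset.mul_sum]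
        refine congrArg (C₁ * ·) (Finset.sum_congr rfl fun e _ => ?_)
        rw [Finset.sum_filter]
    _ = C₁ * ∑ y ∈ KV, ∑ e ∈ KE, (if y ∈ CV e then Piv KE KV A p s (Sum.inr y) else 0) := by
        rw [Finset.sum_comm]
    _ = C₁ * ∑ y ∈ KV, ((KE.filter fun e => y ∈ CV e).card : ℝ) * Piv KE KV A p s (Sum.inr y) := by
        refine congrArg (C₁ * ·) (Finset.sum_congr rfl fun y _ => ?_)
        rw [← Finset.sum_filter, Finset.sum_const, nsmul_eq_mul]
    _ ≤ C₁ * ∑ y ∈ KV, (NM : ℝ) * Piv KE KV A p s (Sum.inr y) := by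
        refine mul_le_mul_of_nonneg_left (Finset.sum_le_sum fun y hy => ?_) hC₁0
        refine mul_le_mul_of_nonneg_right ?_ (hPiv0 y)
        exact_mod_cast hNM y hy
    _ = AGconst NE NV NM μ₀ * ∑ y ∈ KV, Piv KE KV A p s (Sum.inr y) := by
        rw [← Finset.mul_sum, hC₁, AGconst]
        ring

end AG

/-! ### Integration along the line -/

section Line

/-- **Integration of (diffineq) along the segment `(p₀ - κt, t)`, `t ∈ [0, t₁]`** (Martineau–Severo,
§6: "(diffineq) implies that `t ↦ θ_L(𝐩(t), 𝐬(t))` is a non-decreasing function"): if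
`κ · C ≤ 1`, the segment stays in `min(p, 1-p) ≥ μ₀` and `t₁ ≤ 1/2`, then
`θ_L(p₀, 0) ≤ θ_L(p₀ - κ t₁, t₁)`. [cite: MartineauSevero2019, §6 (the line segment argument)] -/
theorem theta_line_mono (hA : IsUpperSet A) {CE : κE → Finset κE} {CV : κE → Finset κV}
    (hmod : LocMod KE KV A CE CV) {NE NV NM : ℕ} (hNE : ∀ e ∈ KE, (CE e).card ≤ NE)
    (hNV : ∀ e ∈ KE, (CV e).card ≤ NV) (hNM : ∀ y ∈ KV, (KE.filter fun e => y ∈ CV e).card ≤ NM)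
    {p₀ κ μ₀ t₁ : ℝ} (hμ₀ : 0 < μ₀) (hμ1 : μ₀ ≤ 1)
    (hκ0 : 0 ≤ κ) (hκ : κ * AGconst NE NV NM μ₀ ≤ 1) (ht₁ : 0 ≤ t₁) (ht₁' : t₁ ≤ 1 / 2)
    (hlo : μ₀ ≤ p₀ - κ * t₁) (hhi : p₀ ≤ 1 - μ₀) :
    Theta KE KV A p₀ 0 ≤ Theta KE KV A (p₀ - κ * t₁) t₁ := by
  set F : ℝ → ℝ := fun t => Theta KE KV A (p₀ - κ * t) t with hF
  have hderiv := fun t => hasDerivAt_theta_line (KE := KE) (KV := KV) hA p₀ κ t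
  have hmono : MonotoneOn F (Set.Icc 0 t₁) := by
    refine monotoneOn_of_hasDerivWithinAt_nonneg (convex_Icc 0 t₁)
      (fun t _ => (hderiv t).continuousAt.continuousWithinAt)
      (fun t _ => (hderiv t).hasDerivWithinAt) fun t ht => ?_
    rw [interior_Icc] at ht
    have hp_lo : μ₀ ≤ p₀ - κ * t := hlo.trans (by nlinarith [ht.2.le, hκ0])
    have hp_hi : μ₀ ≤ 1 - (p₀ - κ * t) := by nlinarith [ht.1.le, hκ0]
    have hAG := sum_piv_inl_le hmod hNE hNV hNM hμ₀ hμ1 hp_lo hp_hi ht.1.le (by linarith [ht.2, ht₁'])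
      (by linarith [ht.2, ht₁'])
    have hB : 0 ≤ ∑ y ∈ KV, Piv KE KV A (p₀ - κ * t) t (Sum.inr y) :=
      Finset.sum_nonneg fun y _ => piv_nonneg ⟨hμ₀.le.trans hp_lo, by linarith⟩
        ⟨ht.1.le, by linarith [ht.2, ht₁']⟩ _
    have hC0 : 0 ≤ AGconst NE NV NM μ₀ := AGconst_nonneg NE NV NM hμ₀.le
    nlinarith [hAG, hB, hκ, hκ0, mul_nonneg hκ0 hB]
  have h := hmono (Set.left_mem_Icc.2 ht₁) (Set.right_mem_Icc.2 ht₁) ht₁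
  simpa [hF] using h

/-- **`θ_L(p, s)` is non-decreasing in `s`** (`A` is increasing; Russo's formula in `s` has a
non-negative right-hand side). [cite: MartineauSevero2019, §6 ("By monotonicity")] -/
theorem theta_mono_s (hA : IsUpperSet A) {p s s' : ℝ} (hp0 : 0 ≤ p) (hp1 : p ≤ 1) (hs0 : 0 ≤ s)
    (hss' : s ≤ s') (hs'1 : s' ≤ 1) : Theta KE KV A p s ≤ Theta KE KV A p s' := by
  set F : ℝ → ℝ := fun t => Theta KE KV A (p - 0 * t) t with hF
  have hderiv := fun t => hasDerivAt_theta_line (KE := KE) (KV := KV) hA p 0 t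
  have hmono : MonotoneOn F (Set.Icc 0 1) := by
    refine monotoneOn_of_hasDerivWithinAt_nonneg (convex_Icc 0 1)
      (fun t _ => (hderiv t).continuousAt.continuousWithinAt)
      (fun t _ => (hderiv t).hasDerivWithinAt) fun t ht => ?_
    rw [interior_Icc] at ht
    have hB : 0 ≤ ∑ y ∈ KV, Piv KE KV A (p - 0 * t) t (Sum.inr y) :=
      Finset.sum_nonneg fun y _ => piv_nonneg ⟨by linarith, by linarith⟩ ⟨ht.1.le, ht.2.le⟩ _
    simpa using hB
  have h := hmono ⟨hs0, hss'.trans hs'1⟩ ⟨hs0.trans hss', hs'1⟩ hss'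
  simpa [hF] using h

/-- **`θ_L(p, s)` is non-decreasing in `p`** (Russo's formula in `p` alone). [cite: MartineauSevero2019, §6 ("By monotonicity")] -/
theorem theta_mono_p (hA : IsUpperSet A) {p p' s : ℝ} (hp0 : 0 ≤ p) (hpp' : p ≤ p') (hp'1 : p' ≤ 1)
    (hs0 : 0 ≤ s) (hs1 : s ≤ 1) : Theta KE KV A p s ≤ Theta KE KV A p' s := by
  -- along `t ↦ (p' - 1·(p' - p - t·0)…)`: use the line with `κ = -1` from `p` upwards
  set F : ℝ → ℝ := fun t => Theta KE KV A (p - (-1) * t) s with hF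
  have hderiv : ∀ t, HasDerivAt F (∑ e ∈ KE, Piv KE KV A (p - (-1) * t) s (Sum.inl e)) t := by
    intro t
    have hq : ∀ i ∈ K KE KV, HasDerivAt (fun t => par (κE := κE) (κV := κV) (p - (-1) * t) s i)
        (Sum.elim (fun _ => (1 : ℝ)) (fun _ => (0 : ℝ)) i) t := by
      intro i _
      cases i with
      | inl e =>
        simp only [par, Sum.elim_inl]
        have := ((hasDerivAt_id t).const_mul (-1 : ℝ)).const_sub p
        simpa using this
      | inr y =>
        simp only [par, Sum.elim_inr]
        exact hasDerivAt_const t s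
    have h := ProdWeight.hasDerivAt_gTheta hA (K KE KV) hq
    refine h.congr_deriv ?_
    simp only [Piv, K, Finset.sum_disjSum, Sum.elim_inl, Sum.elim_inr, one_mul, zero_mul,
      Finset.sum_const_zero, add_zero]
  have hmono : MonotoneOn F (Set.Icc 0 (p' - p)) := by
    refine monotoneOn_of_hasDerivWithinAt_nonneg (convex_Icc 0 (p' - p))
      (fun t _ => (hderiv t).continuousAt.continuousWithinAt)
      (fun t _ => (hderiv t).hasDerivWithinAt) fun t ht => ?_
    rw [interior_Icc] at ht
    exact Finset.sum_nonneg fun e _ => piv_nonneg ⟨by nlinarith [ht.1], by nlinarith [ht.2]⟩ ⟨hs0, hs1⟩ _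
  have h := hmono (Set.left_mem_Icc.2 (by linarith)) (Set.right_mem_Icc.2 (by linarith)) (by linarith)
  simp only [hF] at h
  have e1 : p - (-1) * 0 = p := by ring
  have e2 : p - (-1) * (p' - p) = p' := by ring
  rw [e1, e2] at h
  exact h

end Line

end AGLine

end Literature.Probability.Percolation
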